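import Literature.Geometry.Lorentzian.BoundedGeometry
import Literature.Geometry.Riemannian.RicciFlowMaximal
import HarnessLib

/-!
# Bounded geometry of an initial data set gives the tree's frame-wise curvature bound
(topic `Geometry/Lorentzian`; leaf file split off `BoundedGeometry.lean` for import hygiene,
definition item `defn-ChartMetric` — no new mathematics)

`InitialDataSet.HasBoundedGeometry.curvatureBoundedBy`: under bounded geometry at scale `Λ⁻¹`
(`InitialDataSet.HasBoundedGeometry D Λ`, `BoundedGeometry.lean`: `|Rm_h| ≤ Λ²` frame-wise,
`|∇k| ≤ Λ²`, `|k|²_h ≤ Λ²`, `inj_h ≥ Λ⁻¹`) the metric `h = D.metric` satisfies the frame-wise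
curvature bound `CurvatureBoundedBy h ∇ʰ Λ²` of `Riemannian/RicciFlowMaximal.lean` (Topping 2006,
(5.3.1): `|Rm(X₁,X₂,X₃,X₄)| ≤ K` for `h`-unit-bounded vectors) — the curvature clause of
`HasBoundedGeometryOn` on `univ` is literally that statement.

This three-line conversion lived in `BoundedGeometry.lean` (2026-08-15/16). It is the only
declaration there that mentions `CurvatureBoundedBy`, whose home `RicciFlowMaximal.lean` carries the
Ricci-flow import cone (and the unproved named fact `ricciFlow_curvature_blowup`); keeping it in this
leaf lets `BoundedGeometry.lean` — and the chart-metric users above it (`LateTimeOmegaLimitSet.lean`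
and the route files importing it) — import only `IsotropicCurvature.lean` from the Ricci-flow files.
Import this file where the conversion to `CurvatureBoundedBy` is wanted.

## References

* [Anderson2004] M. T. Anderson, *Cheeger–Gromov theory and applications to general relativity*
  (2004), arXiv:gr-qc/0208079: §2, Thm. 2.2 and §5, (5.3)–(5.5) (curvature bound of bounded
  geometry).
* P. Topping, *Lectures on the Ricci flow*, LMS Lecture Note Series 325 (2006), (5.3.1) (the norm
  of the curvature tensor bounded by `K`).
-/

noncomputable section

open Set
open scoped Manifold ContDiff

namespace Literature.Geometry.Lorentzian

namespace InitialDataSet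

open Literature.Geometry.Riemannian (CurvatureBoundedBy)

variable {E : Type*} [NormedAddCommGroup E] [NormedSpace ℝ E] {H : Type*} [TopologicalSpace H]
  {I : ModelWithCorners ℝ E H} {X : Type*} [TopologicalSpace X] [ChartedSpace H X]
  [IsManifold I ∞ X] [FiniteDimensional ℝ E]

variable {D : InitialDataSet I X} [D.metric.HasLeviCivita]

/-- The curvature clause of bounded geometry is the tree's frame-wise curvature bound
`CurvatureBoundedBy h ∇ʰ Λ²` (`RicciFlowMaximal.lean`; Topping 2006, (5.3.1)). [folklore] -/
theorem HasBoundedGeometry.curvatureBoundedBy {Λ : ℝ} (h : D.HasBoundedGeometry Λ) :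
    CurvatureBoundedBy D.metric D.metric.leviCivita (Λ ^ 2) :=
  fun x X₁ X₂ X₃ X₄ h₁ h₂ h₃ h₄ ↦ h.abs_curvatureForm_le x (mem_univ x) X₁ X₂ X₃ X₄ h₁ h₂ h₃ h₄

end InitialDataSet

end Literature.Geometry.Lorentzian

end
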